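import Mathlib
import Summits.ResolutionOfSingularities.ResolutionOfSingularities.Theorems.WeightedInvariantLocalWeightedDropSpaceCountGame

/-!
# `WeightedInvariant.LocalWeightedDrop`: the N = 4 tame residual T″|₄ from an ORDINAL RANK of the normal-crossing game on
# surface germs — transfinite game values, radical transport, and the ordinal tuple-game assembly

Crux item stmt-ResolutionOfSingularities-8899 `LocalWeightedDrop` (route `ResolutionOfSingularities/WeightedInvariant`), ENGINE
skeleton v31 (fb48e93459d3708f), residual `stub_tameWideApexFourStartsWon` (T″|₄).  [OURS · L1 W4.3 · chain w43 · lead-1 gen 4 (engine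
registrar).  Game-theoretic bookkeeping over `k⟦x⟧`; the count game (`WinsIn`, `IsCountMove`, `MoveClause`, res-type-056) and the tuple game
(`TupleGame.Drop`) are the programme's own objects; nothing here is a statement of any manuscript.  AI-produced, gate-checked, weaker than
expert review.]

WHAT THIS FILE DOES.  res-L1-w43-stub-1's N4-TAME-CENSUS (10:10Z, (C)) records that T″|₄ is, modulo landed kernel, exactly
(TOT₂) «`∀ b ≠ 0 : k⟦x₀,x₁,x₂⟧, ∃ n, WinsIn GermIsNC n b`» — embedded normal-crossings resolution of surface germs in 3-space by smooth-centre
blow-ups with a UNIFORM bound `n` on the number of rounds over all the opponent's (infinitely many) answers.  The uniform bound is an artefact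
of the ℕ-valued count `GermNonNCCountRad`; the consumer `TupleGame.Drop` only needs an ORDINAL rank.  We remove the artefact:

* `RankedRegion P T ρ` / `WinsOrd P α b` — TRANSFINITE WINNABILITY: a set of positions `T ∋ b`, ranked by `ρ : k⟦x⟧ → Ordinal` with
  `ρ b ≤ α`, such that from every non-terminal `d ∈ T` some move keeps every successor in `T` with smaller rank (no recursion, no inductive
  type: a ranked winning region is the certificate);
* `winsOrd_of_winsIn` — finite-depth winnability is the special case `α < ω`;
* `winsOrd_of_dvd_pow` — RADICAL TRANSPORT (strategy stealing, as `winsIn_of_dvd_pow`): for radical-hereditary `P`, `WinsOrd P α d`,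
  `b ∣ d^(N+1)`, `d ≠ 0` ⇒ `WinsOrd P α b`;
* `gameRank`, `rank_of_winsOrd` — the least `α` is an ordinal-valued count with EXACTLY the clauses (i) `ν b = 0 ↔ P b`, (ii) radical
  monotonicity, (iii) the move clause, of `GermNonNCCountRad` (ordinals for naturals);
* `winsOrd_of_rankDrop` — the working interface for provers: ONE ordinal rank `ρ` on germs which SOME smooth-centre move lowers at every
  exceptional point of every non-normal-crossing germ (the literal analogue, for the normal-crossing game in fixed dimension, of the shape
  of `LocalWeightedDrop`) gives `WinsOrd` everywhere;
* the ordinal tuple-game assembly and the composition to T″|₄ VERBATIM (`tameWideApexFourStartsWon_of_ncRankDrop`), together with the links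
  (TOT₂) ⇒ interface ⇐ ⟨F-32bR⟩, are in the sequel `…NCGameRankTupleDrop.lean`.
-/

set_option linter.dupNamespace false -- mandated namespace of this single-conjunct summit

noncomputable section

namespace Summit.ResolutionOfSingularities.ResolutionOfSingularities.Theorems

namespace TameFourTupleDrop

open MvPowerSeries Literature.AlgebraicGeometry.Resolution

variable {k : Type} [Field k] {m : ℕ}

/-! ## Ranked winning regions and transfinite winnability -/

/-- A RANKED WINNING REGION for the terminal predicate `P`: a set of positions `T` and a rank `ρ` such that from every non-terminal
position of `T` some move of the count game keeps every successor inside `T` with strictly smaller rank. -/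
def RankedRegion (P : MvPowerSeries (Fin (m + 1)) k → Prop) (T : Set (MvPowerSeries (Fin (m + 1)) k))
    (ρ : MvPowerSeries (Fin (m + 1)) k → Ordinal.{0}) : Prop :=
  ∀ d ∈ T, ¬ P d → ∃ (Φ : Fin (m + 1) → MvPowerSeries (Fin (m + 1)) k) (w : Fin (m + 1) → ℕ),
    IsCountMove Φ w ∧ MoveClause d Φ w (fun d' => d' ∈ T ∧ ρ d' < ρ d)

/-- `WinsOrd P α b`: TRANSFINITE WINNABILITY with game value at most `α` — some ranked winning region contains `b` with rank `≤ α`. -/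
def WinsOrd (P : MvPowerSeries (Fin (m + 1)) k → Prop) (α : Ordinal.{0}) (b : MvPowerSeries (Fin (m + 1)) k) : Prop :=
  ∃ (T : Set (MvPowerSeries (Fin (m + 1)) k)) (ρ : MvPowerSeries (Fin (m + 1)) k → Ordinal.{0}),
    RankedRegion P T ρ ∧ b ∈ T ∧ ρ b ≤ α

/-- A terminal position is won with value `0` (the one-point region). -/
theorem winsOrd_of_terminal {P : MvPowerSeries (Fin (m + 1)) k → Prop} {b : MvPowerSeries (Fin (m + 1)) k} (hb : P b)
    (α : Ordinal.{0}) : WinsOrd P α b :=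
  ⟨{b}, fun _ => 0, fun d hd hPd => absurd (by rw [Set.mem_singleton_iff.mp hd]; exact hb) hPd, Set.mem_singleton b,
    bot_le⟩

/-- `WinsOrd` is monotone in the value. -/
theorem WinsOrd.mono {P : MvPowerSeries (Fin (m + 1)) k → Prop} {α α' : Ordinal.{0}} (hle : α ≤ α')
    {b : MvPowerSeries (Fin (m + 1)) k} (h : WinsOrd P α b) : WinsOrd P α' b := by
  obtain ⟨T, ρ, hT, hb, hρ⟩ := h
  exact ⟨T, ρ, hT, hb, hρ.trans hle⟩

/-- From a non-terminal position of value `≤ α` some move leads only to positions of value `< α`. -/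
theorem WinsOrd.exists_move {P : MvPowerSeries (Fin (m + 1)) k → Prop} {α : Ordinal.{0}} {b : MvPowerSeries (Fin (m + 1)) k}
    (h : WinsOrd P α b) (hPb : ¬ P b) :
    ∃ (Φ : Fin (m + 1) → MvPowerSeries (Fin (m + 1)) k) (w : Fin (m + 1) → ℕ),
      IsCountMove Φ w ∧ MoveClause b Φ w (fun b' => ∃ β < α, WinsOrd P β b') := by
  obtain ⟨T, ρ, hT, hb, hρ⟩ := h
  obtain ⟨Φ, w, hmv, hcl⟩ := hT b hb hPb
  exact ⟨Φ, w, hmv, hcl.mono fun d' ⟨hd', hlt⟩ => ⟨ρ d', lt_of_lt_of_le hlt hρ, T, ρ, hT, hd', le_rfl⟩⟩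

/-- FINITE-DEPTH WINNABILITY IS TRANSFINITE WINNABILITY with finite value. -/
theorem winsOrd_of_winsIn {P : MvPowerSeries (Fin (m + 1)) k → Prop} {n : ℕ} {b : MvPowerSeries (Fin (m + 1)) k}
    (h : WinsIn P n b) : WinsOrd P (n : Ordinal.{0}) b := by
  classical
  -- the region of finitely winnable positions, ranked by the least number of rounds
  let T : Set (MvPowerSeries (Fin (m + 1)) k) := {d | ∃ j, WinsIn P j d}
  have hex : ∀ d ∈ T, ∃ j, WinsIn P j d := fun d hd => hd
  let ρ : MvPowerSeries (Fin (m + 1)) k → Ordinal.{0} := fun d =>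
    if hd : d ∈ T then ((Nat.find (hex d hd) : ℕ) : Ordinal.{0}) else 0
  refine ⟨T, ρ, ?_, ⟨n, h⟩, ?_⟩
  · intro d hd hPd
    have hspec := Nat.find_spec (hex d hd)
    obtain ⟨j, hj⟩ : ∃ j, Nat.find (hex d hd) = j + 1 := by
      rcases hj0 : Nat.find (hex d hd) with _ | j
      · rw [hj0] at hspec; exact absurd hspec hPd
      · exact ⟨j, rfl⟩
    rw [hj] at hspec
    rcases hspec with hspec | ⟨Φ, w, hmv, hcl⟩
    · exact absurd (Nat.find_min' (hex d hd) hspec) (by omega)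
    refine ⟨Φ, w, hmv, hcl.mono fun d' hd' => ?_⟩
    have hd'T : d' ∈ T := ⟨j, hd'⟩
    refine ⟨hd'T, ?_⟩
    simp only [ρ, dif_pos hd'T, dif_pos hd, Nat.cast_lt, hj]
    exact Nat.lt_succ_of_le (Nat.find_min' (hex d' hd'T) hd')
  · have hbT : b ∈ T := ⟨n, h⟩
    simp only [ρ, dif_pos hbT, Nat.cast_le]
    exact Nat.find_min' (hex b hbT) h

/-! ## Radical transport -/

/-- THE DIVISIBILITY BEHIND STRATEGY STEALING: if `b ∣ d^(N+1)` and `b`, `d` are transformed by the same legal move and the same chart, with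
`s`-saturations `b∘Φ(chart) = s^{A_b} G_b` and `d∘Φ(chart) = s^{A_d} G_d`, `s ∤ G_d`, then at every slot the new position of `b` divides a
power of the new position of `d`: `s · G_b| ∣ (s · G_d|)^(M+1)`. -/
theorem successor_dvd_pow {b d q : MvPowerSeries (Fin (m + 1)) k} {N : ℕ} (hq : d ^ (N + 1) = b * q)
    {Φ : Fin (m + 1) → MvPowerSeries (Fin (m + 1)) k} (hΦ0 : ∀ i, constantCoeff (Φ i) = 0)
    {w : Fin (m + 1) → ℕ} {c : Fin (m + 1) → k} (hc : ∀ i, w i = 0 → c i = 0)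
    {Ab Ad : ℕ} {Gb Gd : MvPowerSeries (Fin (m + 1 + 1)) k}
    (hfacb : subst (CobordantChart.chart w c) (subst Φ b) = X 0 ^ Ab * Gb)
    (hfacd : subst (CobordantChart.chart w c) (subst Φ d) = X 0 ^ Ad * Gd) (hGd : ¬ X 0 ∣ Gd) (i : Fin (m + 1)) :
    ∃ M : ℕ, X 0 * TupleGame.slice i Gb ∣ (X 0 * TupleGame.slice i Gd) ^ (M + 1) := by
  have hΦs : HasSubst Φ := hasSubst_of_constantCoeff_zero hΦ0
  have hch := CobordantChart.hasSubst_chart w c hc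
  have hdiv : X 0 ^ Ab * Gb ∣ X 0 ^ (Ad * (N + 1)) * Gd ^ (N + 1) := by
    have hTd : (subst (CobordantChart.chart w c) (subst Φ d)) ^ (N + 1) =
        subst (CobordantChart.chart w c) (subst Φ b) * subst (CobordantChart.chart w c) (subst Φ q) := by
      rw [← coe_substAlgHom hΦs, ← coe_substAlgHom hch, ← map_pow, ← map_pow, hq, map_mul, map_mul]
    refine ⟨subst (CobordantChart.chart w c) (subst Φ q), ?_⟩
    rw [← hfacb, ← hTd, hfacd, mul_pow, ← pow_mul]
  obtain ⟨-, hGdiv⟩ := dvd_of_X_pow_mul_dvd (not_X_dvd_pow hGd (N + 1)) hdiv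
  set r := Ad * (N + 1) - Ab
  refine ⟨r + N, ?_⟩
  obtain ⟨u, hu⟩ := hGdiv
  refine ⟨X 0 ^ N * TupleGame.slice i Gd ^ r * TupleGame.slice i u, ?_⟩
  have hs := congrArg (TupleGame.slice i) hu
  rw [MultiplicityLift.slice_X_zero_pow_mul, slice_mul, slice_pow] at hs
  calc (X 0 * TupleGame.slice i Gd) ^ (r + N + 1)
      = X 0 ^ (N + 1) * TupleGame.slice i Gd ^ r * (X 0 ^ r * TupleGame.slice i Gd ^ (N + 1)) := by ring
    _ = X 0 ^ (N + 1) * TupleGame.slice i Gd ^ r * (TupleGame.slice i Gb * TupleGame.slice i u) := by rw [hs]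
    _ = X 0 * TupleGame.slice i Gb * (X 0 ^ N * TupleGame.slice i Gd ^ r * TupleGame.slice i u) := by ring

/-- RADICAL TRANSPORT OF TRANSFINITE WINNABILITY (strategy stealing).  If `P` is radical-hereditary, then `WinsOrd P α d`, `d ≠ 0` and
`b ∣ d^(N+1)` give `WinsOrd P α b`: the region of all non-zero radical divisors of `d`'s region, ranked by the least rank of a witness,
playing the witness's move. -/
theorem winsOrd_of_dvd_pow {P : MvPowerSeries (Fin (m + 1)) k → Prop}
    (hP : ∀ (N : ℕ) (b d : MvPowerSeries (Fin (m + 1)) k), d ≠ 0 → P d → b ∣ d ^ (N + 1) → P b)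
    {α : Ordinal.{0}} {N : ℕ} {b d : MvPowerSeries (Fin (m + 1)) k} (hd : d ≠ 0) (hwin : WinsOrd P α d)
    (hbd : b ∣ d ^ (N + 1)) : WinsOrd P α b := by
  classical
  obtain ⟨T, ρ, hT, hdT, hρd⟩ := hwin
  -- witnesses: non-zero members of `T` of which the position is a radical divisor
  let Wit : MvPowerSeries (Fin (m + 1)) k → Set (MvPowerSeries (Fin (m + 1)) k) :=
    fun b' => {d' | d' ∈ T ∧ d' ≠ 0 ∧ ∃ M : ℕ, b' ∣ d' ^ (M + 1)}
  let T' : Set (MvPowerSeries (Fin (m + 1)) k) := {b' | (Wit b').Nonempty}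
  let ρ' : MvPowerSeries (Fin (m + 1)) k → Ordinal.{0} := fun b' => sInf (ρ '' Wit b')
  have hbT' : b ∈ T' := ⟨d, hdT, hd, N, hbd⟩
  refine ⟨T', ρ', ?_, hbT', ?_⟩
  · intro b' hb' hPb'
    -- a witness of least rank
    have hne : (ρ '' Wit b').Nonempty := hb'.image ρ
    obtain ⟨d', ⟨hd'T, hd'0, M, hM⟩, hd'ρ⟩ := (Set.mem_image _ _ _).mp (csInf_mem hne)
    have hPd' : ¬ P d' := fun h => hPb' (hP M b' d' hd'0 h hM)
    obtain ⟨Φ, w, hmv, hcl⟩ := hT d' hd'T hPd'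
    refine ⟨Φ, w, hmv, ?_⟩
    intro c hc hc0 Ab Gb hfacb hGb
    obtain ⟨hΦ0, hdet, hw1, -⟩ := hmv
    have hD : subst (CobordantChart.chart w c) (subst Φ d') ≠ 0 :=
      CobordantChart.subst_chart_ne_zero w c hc (FormalCoordChange.subst_ne_zero_of_isUnit_det hΦ0 hdet hd'0)
    obtain ⟨Ad, Gd, hfacd, hGd⟩ := CobordantVertexChart.exists_eq_X_pow_mul_not_dvd hD
    obtain ⟨i, hci, hmem, hlt⟩ := hcl c hc hc0 Ad Gd hfacd hGd
    obtain ⟨q, hq⟩ := hM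
    obtain ⟨M', hM'⟩ := successor_dvd_pow hq hΦ0 hc hfacb hfacd hGd i
    have hne' : X 0 * TupleGame.slice i Gd ≠ 0 :=
      mul_ne_zero (MvPowerSeries.prime_X' k (0 : Fin (m + 1))).ne_zero
        (TupleDropAssembly.slice_ne_zero (subst Φ d') w c hc hw1 Ad Gd hfacd hGd i hci)
    have hwit : X 0 * TupleGame.slice i Gd ∈ Wit (X 0 * TupleGame.slice i Gb) := ⟨hmem, hne', M', hM'⟩
    refine ⟨i, hci, ⟨_, hwit⟩, ?_⟩
    calc ρ' (X 0 * TupleGame.slice i Gb)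
        ≤ ρ (X 0 * TupleGame.slice i Gd) := csInf_le' (Set.mem_image_of_mem ρ hwit)
      _ < ρ d' := hlt
      _ = ρ' b' := hd'ρ
  · calc ρ' b ≤ ρ d := csInf_le' (Set.mem_image_of_mem ρ (show d ∈ Wit b from ⟨hdT, hd, N, hbd⟩))
      _ ≤ α := hρd

/-! ## The game rank -/

section Rank

variable (P : MvPowerSeries (Fin (m + 1)) k → Prop)

open Classical in
/-- THE GAME RANK: the least value `α` with `WinsOrd P α b` (and `0` if there is none). -/
def gameRank (b : MvPowerSeries (Fin (m + 1)) k) : Ordinal.{0} :=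
  sInf {α | WinsOrd P α b}

/-- The game rank is attained on winnable positions. -/
theorem winsOrd_gameRank {b : MvPowerSeries (Fin (m + 1)) k} (h : ∃ α, WinsOrd P α b) : WinsOrd P (gameRank P b) b :=
  csInf_mem (s := {α | WinsOrd P α b}) h

/-- The game rank is minimal. -/
theorem gameRank_le {b : MvPowerSeries (Fin (m + 1)) k} {α : Ordinal.{0}} (h : WinsOrd P α b) : gameRank P b ≤ α :=
  csInf_le' (show α ∈ {α | WinsOrd P α b} from h)

/-- Clause (i), easy direction: terminal positions have rank `0`. -/
theorem gameRank_eq_zero_of_terminal {b : MvPowerSeries (Fin (m + 1)) k} (hb : P b) : gameRank P b = 0 :=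
  le_antisymm (gameRank_le P (winsOrd_of_terminal hb 0)) bot_le

/-- A position of value `0` is terminal, provided it is not the zero germ (every legal move has an exceptional point and a
factorisation, and a successor would have negative rank). -/
theorem terminal_of_winsOrd_zero {b : MvPowerSeries (Fin (m + 1)) k} (hb : b ≠ 0) (h : WinsOrd P 0 b) : P b := by
  by_contra hPb
  obtain ⟨Φ, w, ⟨hΦ0, hdet, -, ⟨i₀, hi₀⟩⟩, hcl⟩ := h.exists_move hPb
  -- the exceptional point `e_{i₀}` and the `s`-saturation of the transform
  let c : Fin (m + 1) → k := Pi.single i₀ 1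
  have hc : ∀ i, w i = 0 → c i = 0 := by
    intro i hi
    by_cases h : i = i₀
    · subst h; omega
    · simp [c, h]
  have hc0 : c ≠ 0 := by
    intro h
    have := congrFun h i₀
    simp [c] at this
  have hB : subst (CobordantChart.chart w c) (subst Φ b) ≠ 0 :=
    CobordantChart.subst_chart_ne_zero w c hc (FormalCoordChange.subst_ne_zero_of_isUnit_det hΦ0 hdet hb)
  obtain ⟨A, G, hfac, hG⟩ := CobordantVertexChart.exists_eq_X_pow_mul_not_dvd hB
  obtain ⟨i, -, β, hβ, -⟩ := hcl c hc hc0 A G hfac hG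
  exact not_lt_zero hβ

/-- Clause (i): for a winnable non-zero position, rank `0` means terminal. -/
theorem gameRank_eq_zero_iff {b : MvPowerSeries (Fin (m + 1)) k} (hb : b ≠ 0) (h : ∃ α, WinsOrd P α b) :
    gameRank P b = 0 ↔ P b := by
  refine ⟨fun h0 => ?_, gameRank_eq_zero_of_terminal P⟩
  have hw := winsOrd_gameRank P h
  rw [h0] at hw
  exact terminal_of_winsOrd_zero P hb hw

/-- Clause (iii): from a winnable non-terminal position the rank-attaining move drops the rank at some live slot of every answer. -/
theorem exists_move_gameRank_lt {b : MvPowerSeries (Fin (m + 1)) k} (h : ∃ α, WinsOrd P α b) (hPb : ¬ P b) :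
    ∃ (Φ : Fin (m + 1) → MvPowerSeries (Fin (m + 1)) k) (w : Fin (m + 1) → ℕ),
      IsCountMove Φ w ∧ MoveClause b Φ w (fun g => gameRank P g < gameRank P b) := by
  obtain ⟨Φ, w, hmv, hcl⟩ := (winsOrd_gameRank P h).exists_move hPb
  exact ⟨Φ, w, hmv, hcl.mono fun g ⟨β, hβ, hg⟩ => lt_of_le_of_lt (gameRank_le P hg) hβ⟩

/-- Clause (ii), given radical heredity of `P`: `b ∣ d^(N+1)`, `d ≠ 0` winnable ⇒ `gameRank b ≤ gameRank d`. -/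
theorem gameRank_le_of_dvd_pow
    (hP : ∀ (N : ℕ) (b d : MvPowerSeries (Fin (m + 1)) k), d ≠ 0 → P d → b ∣ d ^ (N + 1) → P b)
    {b d : MvPowerSeries (Fin (m + 1)) k} (hd : d ≠ 0) (hdw : ∃ α, WinsOrd P α d) {N : ℕ} (hbd : b ∣ d ^ (N + 1)) :
    gameRank P b ≤ gameRank P d :=
  gameRank_le P (winsOrd_of_dvd_pow hP hd (winsOrd_gameRank P hdw) hbd)

/-- **THE ORDINAL COUNT FROM TRANSFINITE WINNABILITY** (dimension- and predicate-generic): if `P` is radical-hereditary and every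
non-zero germ is transfinitely winnable, the game rank is an ordinal-valued count with the clauses (i) `ν b = 0 ↔ P b`, (ii) radical
monotonicity, (iii) the move clause — the shapes of `GermNonNCCountRad` / `tupleDrop_of_count_of_monomialPhase` with `Ordinal` for `ℕ`. -/
theorem rank_of_winsOrd
    (hP : ∀ (N : ℕ) (b d : MvPowerSeries (Fin (m + 1)) k), d ≠ 0 → P d → b ∣ d ^ (N + 1) → P b)
    (hwin : ∀ b : MvPowerSeries (Fin (m + 1)) k, b ≠ 0 → ∃ α, WinsOrd P α b) :
    ∃ ν : MvPowerSeries (Fin (m + 1)) k → Ordinal.{0},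
      (∀ b : MvPowerSeries (Fin (m + 1)) k, b ≠ 0 → (ν b = 0 ↔ P b)) ∧
      (∀ b d : MvPowerSeries (Fin (m + 1)) k, d ≠ 0 → ∀ N : ℕ, b ∣ d ^ (N + 1) → ν b ≤ ν d) ∧
      (∀ b : MvPowerSeries (Fin (m + 1)) k, b ≠ 0 → ¬ P b →
        ∃ (Φ : Fin (m + 1) → MvPowerSeries (Fin (m + 1)) k) (w : Fin (m + 1) → ℕ),
          (∀ i, MvPowerSeries.constantCoeff (Φ i) = 0) ∧
          IsUnit (Matrix.det (Matrix.of fun i j => MvPowerSeries.coeff (Finsupp.single j 1) (Φ i))) ∧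
          (∀ i, w i ≤ 1) ∧ (∃ i, 0 < w i) ∧
          ∀ c : Fin (m + 1) → k, (∀ i, w i = 0 → c i = 0) → c ≠ 0 →
            ∀ (A : ℕ) (G : MvPowerSeries (Fin (m + 1 + 1)) k),
              MvPowerSeries.subst (CobordantChart.chart w c) (MvPowerSeries.subst Φ b) = MvPowerSeries.X 0 ^ A * G →
              ¬ (MvPowerSeries.X (0 : Fin (m + 1 + 1)) ∣ G) →
              ∃ i : Fin (m + 1), c i ≠ 0 ∧ ν (MvPowerSeries.X 0 * TupleGame.slice i G) < ν b) := by
  refine ⟨gameRank P, fun b hb => gameRank_eq_zero_iff P hb (hwin b hb), fun b d hd N hbd => ?_, fun b hb hPb => ?_⟩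
  · -- (ii): either `b = 0` (then its rank is `0` by convention… but `b ∣ d^(N+1)` with `d ≠ 0` forces `b ≠ 0`)
    have hb : b ≠ 0 := by
      rintro rfl
      exact pow_ne_zero (N + 1) hd (zero_dvd_iff.mp hbd)
    exact gameRank_le_of_dvd_pow P hP hd (hwin d hd) hbd
  · obtain ⟨Φ, w, ⟨hΦ0, hdet, hw1, hwpos⟩, hcl⟩ := exists_move_gameRank_lt P (hwin b hb) hPb
    exact ⟨Φ, w, hΦ0, hdet, hw1, hwpos, hcl⟩

end Rank

/-! ## The working interface: one ordinal rank lowered by some move -/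

/-- SUCCESSORS ARE NON-ZERO: the move clause may always be strengthened by `b' ≠ 0` (a legal move, a non-zero position). -/
theorem MoveClause.and_ne_zero {b : MvPowerSeries (Fin (m + 1)) k} (hb : b ≠ 0) {Φ : Fin (m + 1) → MvPowerSeries (Fin (m + 1)) k}
    {w : Fin (m + 1) → ℕ} (hmv : IsCountMove Φ w) {good : MvPowerSeries (Fin (m + 1)) k → Prop} (h : MoveClause b Φ w good) :
    MoveClause b Φ w (fun b' => b' ≠ 0 ∧ good b') := by
  intro c hc hc0 A G hfac hG
  obtain ⟨i, hci, hgood⟩ := h c hc hc0 A G hfac hG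
  obtain ⟨hΦ0, hdet, hw1, -⟩ := hmv
  have _ := FormalCoordChange.subst_ne_zero_of_isUnit_det hΦ0 hdet hb
  exact ⟨i, hci, mul_ne_zero (MvPowerSeries.prime_X' k (0 : Fin (m + 1))).ne_zero
    (TupleDropAssembly.slice_ne_zero (subst Φ b) w c hc hw1 A G hfac hG i hci), hgood⟩

/-- **FROM A RANK THAT SOME MOVE LOWERS TO TRANSFINITE WINNABILITY.**  If one ordinal rank `ρ` on germs is lowered, at every exceptional
point of SOME smooth-centre move, from every non-zero non-terminal germ, then every non-zero germ is transfinitely winnable (the region of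
all non-zero germs, ranked by `ρ`). -/
theorem winsOrd_of_rankDrop {P : MvPowerSeries (Fin (m + 1)) k → Prop} (ρ : MvPowerSeries (Fin (m + 1)) k → Ordinal.{0})
    (hdrop : ∀ b : MvPowerSeries (Fin (m + 1)) k, b ≠ 0 → ¬ P b →
      ∃ (Φ : Fin (m + 1) → MvPowerSeries (Fin (m + 1)) k) (w : Fin (m + 1) → ℕ),
        IsCountMove Φ w ∧ MoveClause b Φ w (fun b' => ρ b' < ρ b)) :
    ∀ b : MvPowerSeries (Fin (m + 1)) k, b ≠ 0 → ∃ α, WinsOrd P α b := by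
  intro b hb
  refine ⟨ρ b, {d | d ≠ 0}, ρ, ?_, hb, le_rfl⟩
  intro d hd hPd
  obtain ⟨Φ, w, hmv, hcl⟩ := hdrop d hd hPd
  exact ⟨Φ, w, hmv, hcl.and_ne_zero hd hmv⟩

end TameFourTupleDrop

end Summit.ResolutionOfSingularities.ResolutionOfSingularities.Theorems

end
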